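import Summits.NavierStokesRegularity.NavierStokesRegularity.Theses.TaoLadderRungOne
import Summits.NavierStokesRegularity.NavierStokesRegularity.Theorems.TaoLadderRungOneSplitCascadeIsAveragedNoDilOfSplit
import Summits.NavierStokesRegularity.NavierStokesRegularity.Theorems.TaoLadderRungOneSingleScaleNoDilAt
import Summits.NavierStokesRegularity.NavierStokesRegularity.Theorems.TaoLadderRungOneCascadeNoDilOfSingleScaleAt
import Summits.NavierStokesRegularity.NavierStokesRegularity.Theorems.TaoLadderRungOneSplitCascadeIsAveragedNoDilStubSplitNoDilPackaging

/-!
# Split closure of `SplitCascadeIsAveragedNoDil` (gate-written; R5, gate window 13, 2026-08-30)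

Item stmt-NavierStokesRegularity-19873 of route route-NavierStokesRegularity-TaoLadderRungOne (`Summits.NavierStokesRegularity.NavierStokesRegularity.Theses.TaoLadderRungOne`) was split (gen 1) into 3 children + glue,
and every child and the glue is closed·proved by an accepted theorem. This module states the derived theorem, so the parent's closer is a
real kernel-checked declaration (rulings 21-frontier F1/F2, 2026-08-30). Do not edit by hand: the gate regenerates it when the family changes.

children: SingleScaleNoDilAt (stmt-NavierStokesRegularity-20473, `Summit.NavierStokesRegularity.NavierStokesRegularity.Theorems.taoLadderRungOne_singleScaleNoDilAt_proof`); CascadeNoDilOfSingleScaleAt (stmt-NavierStokesRegularity-20433, `Summit.NavierStokesRegularity.NavierStokesRegularity.Theorems.taoLadderRungOne_cascadeNoDilOfSingleScaleAt_proof`); SplitNoDilPackaging (stmt-NavierStokesRegularity-20474, `Summit.NavierStokesRegularity.NavierStokesRegularity.Theorems.SplitCascadeIsAveragedNoDil.Split.stub_splitNoDilPackaging`)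
glue: SplitCascadeIsAveragedNoDilOfSplit (stmt-NavierStokesRegularity-20435, `Summit.NavierStokesRegularity.NavierStokesRegularity.Theorems.taoLadderRungOne_splitCascadeIsAveragedNoDilOfSplit_proof`)
-/

namespace Summit.NavierStokesRegularity.NavierStokesRegularity.Theorems.SplitClosure.TaoLadderRungOne

/-- `SplitCascadeIsAveragedNoDil` holds BY SPLIT (gen 1): the glue applied to the proved children. -/
theorem SplitCascadeIsAveragedNoDil_holds : _root_.Summit.NavierStokesRegularity.NavierStokesRegularity.Theses.TaoLadderRungOne.SplitCascadeIsAveragedNoDil :=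
  (show _root_.Summit.NavierStokesRegularity.NavierStokesRegularity.Theses.TaoLadderRungOne.SingleScaleNoDilAt → _root_.Summit.NavierStokesRegularity.NavierStokesRegularity.Theses.TaoLadderRungOne.CascadeNoDilOfSingleScaleAt → _root_.Summit.NavierStokesRegularity.NavierStokesRegularity.Theses.TaoLadderRungOne.SplitNoDilPackaging → _root_.Summit.NavierStokesRegularity.NavierStokesRegularity.Theses.TaoLadderRungOne.SplitCascadeIsAveragedNoDil
    from _root_.Summit.NavierStokesRegularity.NavierStokesRegularity.Theorems.taoLadderRungOne_splitCascadeIsAveragedNoDilOfSplit_proof)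
    (show _root_.Summit.NavierStokesRegularity.NavierStokesRegularity.Theses.TaoLadderRungOne.SingleScaleNoDilAt from _root_.Summit.NavierStokesRegularity.NavierStokesRegularity.Theorems.taoLadderRungOne_singleScaleNoDilAt_proof)
    (show _root_.Summit.NavierStokesRegularity.NavierStokesRegularity.Theses.TaoLadderRungOne.CascadeNoDilOfSingleScaleAt from _root_.Summit.NavierStokesRegularity.NavierStokesRegularity.Theorems.taoLadderRungOne_cascadeNoDilOfSingleScaleAt_proof)
    (show _root_.Summit.NavierStokesRegularity.NavierStokesRegularity.Theses.TaoLadderRungOne.SplitNoDilPackaging from _root_.Summit.NavierStokesRegularity.NavierStokesRegularity.Theorems.SplitCascadeIsAveragedNoDil.Split.stub_splitNoDilPackaging)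

end Summit.NavierStokesRegularity.NavierStokesRegularity.Theorems.SplitClosure.TaoLadderRungOne
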